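import Summits.Ventures.LatticeQCDFlow.Scoring.UNOnePlaquetteCumulants
import Summits.Ventures.LatticeQCDFlow.Scoring.SUNOnePlaquetteBesselSeries
import Summits.Ventures.LatticeQCDFlow.TrivializingMaps.HaarTraceMomentsSUn
import Summits.Ventures.LatticeQCDFlow.TrivializingMaps.PlaquetteHaarMoments
import HarnessLib

/-!
# The `SU(N)` one-plaquette law for every `N`: analyticity of the Bars–Green series, `(log Z)' =` plaquette, monotonicity, cumulants, `plaquette → 1`

HONEST FRAMING: exact (Metropolis-corrected) sampling algorithms for lattice gauge theory;
figures of merit are autocorrelation/cost numbers at stated couplings and volumes; no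
continuum-physics claim.

Venture `LatticeQCDFlow` (cell pub-lqcd), sub-topic `Scoring`; FANOUT row 5 (`s0-sun-a`), GEN-17.
NEW WORK of the cell (placement rule).  The `SU(N)` twin of `OnePlaquetteHaarMGF.lean` /
`UNOnePlaquetteCumulants.lean`, built on `SUNOnePlaquetteBesselSeries` (`∫_{SU(N)} e^{x Re tr U} dU =
Σ_{q∈ℤ} det[I_{|q+i−j|}(x)]`, `N ≥ 1`):

* §1 `mgf_{Re tr}(x) = Σ_q det[I_{|q+i−j|}(x)]` under Haar on `SU(N)`; the series is REAL-ANALYTIC in `x`, its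
  logarithm is convex, theory-2's `SU(N)` one-plaquette PLAQUETTE is `(1/N)(log Σ_q det)'(β)` and NON-DECREASING in
  `β` (GEN-16's `SU(3)` monotonicity on the Weyl torus is the case `N = 3`, now on the Haar measure);
* §2 strong coupling (theory-1's `∫_{SU(N)} Re tr = 0` for `N ≥ 2`, `∫ (Re tr)² = ½` for `N ≥ 3`): `(log Z)'(0) = 0`,
  `(log Z)''(0) = ½`, **plaquette slope `1/(2N)` at `β = 0` for every `N ≥ 3`** (GEN-16's `1/18` per table unit is
  `(1/3)·(1/6)`; `SU(2)` has `∫ tr² = 1`);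
* §3 the plaquette VARIANCE is `(1/N²)(log Σ_q det)''(β)`;
* §4 weak coupling: `(log Σ_q det)'(β) → N` and **the plaquette `→ 1` as `β → ∞`**, every `N ≥ 1`.

No `def`, nothing cited as a fact, 0 sorry.
-/

noncomputable section

open Real MeasureTheory Filter Topology Finset Complex Set
open scoped ENNReal
open ProbabilityTheory
open Literature.MathematicalPhysics.QuantumFieldTheory
open Literature.MathematicalPhysics.QuantumLattice
open Literature.Analysis.FunctionSpaces

namespace Summit.Ventures.LatticeQCDFlow.Scoring

/-! ### 1. The Bars–Green series as a moment generating function -/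

/-- `|Re tr U| ≤ N` on `SU(N)`. -/
theorem abs_trace_re_le_card_su {n : Type*} [Fintype n] [DecidableEq n] (u : Matrix.specialUnitaryGroup n ℂ) :
    |((u : Matrix.specialUnitaryGroup n ℂ) : Matrix n n ℂ).trace.re| ≤ Fintype.card n :=
  abs_trace_re_le_card ⟨(u : Matrix n n ℂ), Matrix.specialUnitaryGroup_le_unitaryGroup u.2⟩

/-- `Re tr` is a.e.-strongly measurable on `SU(N)`. -/
theorem aestronglyMeasurable_trace_re_specialUnitaryGroup (N : ℕ) :
    AEStronglyMeasurable (fun u : Matrix.specialUnitaryGroup (Fin N) ℂ =>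
      ((u : Matrix.specialUnitaryGroup (Fin N) ℂ) : Matrix (Fin N) (Fin N) ℂ).trace.re)
      (haarProbability (Matrix.specialUnitaryGroup (Fin N) ℂ)) :=
  (Complex.continuous_re.comp (continuous_id.matrix_trace.comp continuous_subtype_val)).aestronglyMeasurable

/-- **`mgf_{Re tr U}(x) = Σ_{q∈ℤ} det[I_{|q+i−j|}(x)]_{N×N}`** under the Haar probability of `SU(N)`, `N ≥ 1`. -/
theorem mgf_trace_re_specialUnitaryGroup (N : ℕ) [NeZero N] (x : ℝ) :
    mgf (fun u : Matrix.specialUnitaryGroup (Fin N) ℂ =>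
        ((u : Matrix.specialUnitaryGroup (Fin N) ℂ) : Matrix (Fin N) (Fin N) ℂ).trace.re)
        (haarProbability (Matrix.specialUnitaryGroup (Fin N) ℂ)) x
      = ∑' q : ℤ, (Matrix.of fun i j : Fin N => besselI (q + (i : ℤ) - (j : ℤ)).natAbs x).det :=
  integral_haar_specialUnitaryGroup_fin_exp_mul_trace_re N x

/-- **The Bars–Green series `x ↦ Σ_q det[I_{|q+i−j|}(x)]` is real-analytic on `ℝ`** (`N ≥ 1`). -/
theorem analyticOnNhd_tsum_det_besselI (N : ℕ) [NeZero N] :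
    AnalyticOnNhd ℝ (fun x : ℝ => ∑' q : ℤ, (Matrix.of fun i j : Fin N => besselI (q + (i : ℤ) - (j : ℤ)).natAbs x).det)
      Set.univ := by
  rw [show (fun x : ℝ => ∑' q : ℤ, (Matrix.of fun i j : Fin N => besselI (q + (i : ℤ) - (j : ℤ)).natAbs x).det)
      = mgf (fun u : Matrix.specialUnitaryGroup (Fin N) ℂ =>
          ((u : Matrix.specialUnitaryGroup (Fin N) ℂ) : Matrix (Fin N) (Fin N) ℂ).trace.re)
          (haarProbability (Matrix.specialUnitaryGroup (Fin N) ℂ)) from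
    funext fun x => (mgf_trace_re_specialUnitaryGroup N x).symm]
  exact analyticOnNhd_mgf_univ (aestronglyMeasurable_trace_re_specialUnitaryGroup N) (fun u => abs_trace_re_le_card_su u)

/-- **`log Σ_q det[I_{|q+i−j|}(x)]` is convex on `ℝ`** (`N ≥ 1`). -/
theorem convexOn_log_tsum_det_besselI (N : ℕ) [NeZero N] :
    ConvexOn ℝ Set.univ (fun x : ℝ =>
      Real.log (∑' q : ℤ, (Matrix.of fun i j : Fin N => besselI (q + (i : ℤ) - (j : ℤ)).natAbs x).det)) := by
  have h := convexOn_cgf_univ (aestronglyMeasurable_trace_re_specialUnitaryGroup N) (fun u => abs_trace_re_le_card_su u)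
  rwa [show cgf (fun u : Matrix.specialUnitaryGroup (Fin N) ℂ => ((u : Matrix.specialUnitaryGroup (Fin N) ℂ) :
      Matrix (Fin N) (Fin N) ℂ).trace.re) (haarProbability (Matrix.specialUnitaryGroup (Fin N) ℂ))
      = fun x => Real.log (∑' q : ℤ, (Matrix.of fun i j : Fin N => besselI (q + (i : ℤ) - (j : ℤ)).natAbs x).det) from
    funext fun x => by rw [cgf, mgf_trace_re_specialUnitaryGroup]] at h

/-- **THEORY-2's `SU(N)` ONE-PLAQUETTE PLAQUETTE IS `(1/N)(log Σ_q det[I_{|q+i−j|}])'`** (`N ≥ 1`). -/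
theorem specialUnitary_plaquette_eq_deriv_log_tsum_det (N : ℕ) [NeZero N] (β : ℝ) :
    (∫ u, ((u : Matrix.specialUnitaryGroup (Fin N) ℂ) : Matrix (Fin N) (Fin N) ℂ).trace.re / N *
          Real.exp (-(β * ((N : ℝ) - ((u : Matrix.specialUnitaryGroup (Fin N) ℂ) : Matrix (Fin N) (Fin N) ℂ).trace.re)))
        ∂(haarProbability (Matrix.specialUnitaryGroup (Fin N) ℂ)))
      / (∫ u, Real.exp (-(β * ((N : ℝ) - ((u : Matrix.specialUnitaryGroup (Fin N) ℂ) :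
          Matrix (Fin N) (Fin N) ℂ).trace.re))) ∂(haarProbability (Matrix.specialUnitaryGroup (Fin N) ℂ)))
      = 1 / N * deriv (fun x : ℝ =>
          Real.log (∑' q : ℤ, (Matrix.of fun i j : Fin N => besselI (q + (i : ℤ) - (j : ℤ)).natAbs x).det)) β := by
  have hint := mem_interior_integrableExpSet_of_abs_le_const
    (aestronglyMeasurable_trace_re_specialUnitaryGroup N) (fun u => abs_trace_re_le_card_su u) β
  have hcgf : (fun x : ℝ => Real.log (∑' q : ℤ, (Matrix.of fun i j : Fin N =>
      besselI (q + (i : ℤ) - (j : ℤ)).natAbs x).det))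
      = cgf (fun u : Matrix.specialUnitaryGroup (Fin N) ℂ => ((u : Matrix.specialUnitaryGroup (Fin N) ℂ) :
          Matrix (Fin N) (Fin N) ℂ).trace.re) (haarProbability (Matrix.specialUnitaryGroup (Fin N) ℂ)) :=
    funext fun x => by rw [cgf, mgf_trace_re_specialUnitaryGroup]
  rw [hcgf, deriv_cgf hint, mgf]
  have hsplit : ∀ u : Matrix.specialUnitaryGroup (Fin N) ℂ,
      Real.exp (-(β * ((N : ℝ) - ((u : Matrix.specialUnitaryGroup (Fin N) ℂ) : Matrix (Fin N) (Fin N) ℂ).trace.re)))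
        = Real.exp (-(N * β)) *
          Real.exp (β * ((u : Matrix.specialUnitaryGroup (Fin N) ℂ) : Matrix (Fin N) (Fin N) ℂ).trace.re) := by
    intro u; rw [← Real.exp_add]; congr 1; ring
  simp_rw [hsplit]
  have h1 : ∀ u : Matrix.specialUnitaryGroup (Fin N) ℂ,
      ((u : Matrix.specialUnitaryGroup (Fin N) ℂ) : Matrix (Fin N) (Fin N) ℂ).trace.re / N *
        (Real.exp (-(N * β)) *
          Real.exp (β * ((u : Matrix.specialUnitaryGroup (Fin N) ℂ) : Matrix (Fin N) (Fin N) ℂ).trace.re))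
      = Real.exp (-(N * β)) / N * (((u : Matrix.specialUnitaryGroup (Fin N) ℂ) : Matrix (Fin N) (Fin N) ℂ).trace.re *
          Real.exp (β * ((u : Matrix.specialUnitaryGroup (Fin N) ℂ) : Matrix (Fin N) (Fin N) ℂ).trace.re)) := by
    intro u; ring
  simp_rw [h1]
  rw [integral_const_mul, integral_const_mul]
  have hZ : 0 < ∫ u, Real.exp (β * ((u : Matrix.specialUnitaryGroup (Fin N) ℂ) : Matrix (Fin N) (Fin N) ℂ).trace.re)
      ∂(haarProbability (Matrix.specialUnitaryGroup (Fin N) ℂ)) := by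
    have hc : Continuous fun u : Matrix.specialUnitaryGroup (Fin N) ℂ =>
        Real.exp (β * ((u : Matrix.specialUnitaryGroup (Fin N) ℂ) : Matrix (Fin N) (Fin N) ℂ).trace.re) :=
      Real.continuous_exp.comp (continuous_const.mul (Complex.continuous_re.comp
        (continuous_id.matrix_trace.comp continuous_subtype_val)))
    exact integral_exp_pos (integrable_exp_mul_of_abs_le_const
      (aestronglyMeasurable_trace_re_specialUnitaryGroup N) (fun u => abs_trace_re_le_card_su u) β)
  have he : Real.exp (-(N * β)) ≠ 0 := (Real.exp_pos _).ne'
  have hN : (N : ℝ) ≠ 0 := Nat.cast_ne_zero.2 (NeZero.ne N)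
  field_simp

/-- **THE `SU(N)` ONE-PLAQUETTE PLAQUETTE IS NON-DECREASING IN THE COUPLING, FOR EVERY `N ≥ 1`**
(GEN-16's `SU(3)` monotonicity is the case `N = 3`, now on the Haar measure). -/
theorem monotone_specialUnitary_plaquette (N : ℕ) [NeZero N] :
    Monotone fun β : ℝ =>
      (∫ u, ((u : Matrix.specialUnitaryGroup (Fin N) ℂ) : Matrix (Fin N) (Fin N) ℂ).trace.re / N *
          Real.exp (-(β * ((N : ℝ) - ((u : Matrix.specialUnitaryGroup (Fin N) ℂ) : Matrix (Fin N) (Fin N) ℂ).trace.re)))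
        ∂(haarProbability (Matrix.specialUnitaryGroup (Fin N) ℂ)))
      / (∫ u, Real.exp (-(β * ((N : ℝ) - ((u : Matrix.specialUnitaryGroup (Fin N) ℂ) :
          Matrix (Fin N) (Fin N) ℂ).trace.re))) ∂(haarProbability (Matrix.specialUnitaryGroup (Fin N) ℂ))) := by
  simp_rw [specialUnitary_plaquette_eq_deriv_log_tsum_det]
  have hcgf : (fun x : ℝ => Real.log (∑' q : ℤ, (Matrix.of fun i j : Fin N =>
      besselI (q + (i : ℤ) - (j : ℤ)).natAbs x).det))
      = cgf (fun u : Matrix.specialUnitaryGroup (Fin N) ℂ => ((u : Matrix.specialUnitaryGroup (Fin N) ℂ) :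
          Matrix (Fin N) (Fin N) ℂ).trace.re) (haarProbability (Matrix.specialUnitaryGroup (Fin N) ℂ)) :=
    funext fun x => by rw [cgf, mgf_trace_re_specialUnitaryGroup]
  rw [hcgf]
  exact (monotone_deriv_cgf (aestronglyMeasurable_trace_re_specialUnitaryGroup N)
    (fun u => abs_trace_re_le_card_su u)).const_mul (by positivity)


/-! ### 2. Strong coupling -/

section StrongCoupling

open Summit.Ventures.LatticeQCDFlow.TrivializingMaps

/-- **`SU(N)`, `β = 0`, `N ≥ 2`**: `(log Σ_q det[I_{|q+i−j|}])'(0) = ∫_{SU(N)} Re tr U dU = 0`. -/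
theorem deriv_log_tsum_det_besselI_zero (N : ℕ) (hN : 2 ≤ N) :
    deriv (fun x : ℝ => Real.log (∑' q : ℤ, (Matrix.of fun i j : Fin N =>
      besselI (q + (i : ℤ) - (j : ℤ)).natAbs x).det)) 0 = 0 := by
  haveI : NeZero N := ⟨by omega⟩
  have hcgf : (fun x : ℝ => Real.log (∑' q : ℤ, (Matrix.of fun i j : Fin N =>
      besselI (q + (i : ℤ) - (j : ℤ)).natAbs x).det))
      = cgf (fun u : Matrix.specialUnitaryGroup (Fin N) ℂ => ((u : Matrix.specialUnitaryGroup (Fin N) ℂ) :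
          Matrix (Fin N) (Fin N) ℂ).trace.re) (haarProbability (Matrix.specialUnitaryGroup (Fin N) ℂ)) :=
    funext fun x => by rw [cgf, mgf_trace_re_specialUnitaryGroup]
  rw [hcgf, deriv_cgf_zero (mem_interior_integrableExpSet_of_abs_le_const
    (aestronglyMeasurable_trace_re_specialUnitaryGroup N) (fun u => abs_trace_re_le_card_su u) 0),
    integral_re_trace_haar_eq_zero hN, zero_div]

/-- **`SU(N)`, `β = 0`, `N ≥ 3`**: `(log Σ_q det[I_{|q+i−j|}])''(0) = Var_{Haar}(Re tr U) = ½`. -/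
theorem iteratedDeriv_two_log_tsum_det_besselI_zero (N : ℕ) (hN : 3 ≤ N) :
    iteratedDeriv 2 (fun x : ℝ => Real.log (∑' q : ℤ, (Matrix.of fun i j : Fin N =>
      besselI (q + (i : ℤ) - (j : ℤ)).natAbs x).det)) 0 = 1 / 2 := by
  haveI : NeZero N := ⟨by omega⟩
  have hint := mem_interior_integrableExpSet_of_abs_le_const
    (aestronglyMeasurable_trace_re_specialUnitaryGroup N) (fun u => abs_trace_re_le_card_su u) 0
  have hcgf : (fun x : ℝ => Real.log (∑' q : ℤ, (Matrix.of fun i j : Fin N =>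
      besselI (q + (i : ℤ) - (j : ℤ)).natAbs x).det))
      = cgf (fun u : Matrix.specialUnitaryGroup (Fin N) ℂ => ((u : Matrix.specialUnitaryGroup (Fin N) ℂ) :
          Matrix (Fin N) (Fin N) ℂ).trace.re) (haarProbability (Matrix.specialUnitaryGroup (Fin N) ℂ)) :=
    funext fun x => by rw [cgf, mgf_trace_re_specialUnitaryGroup]
  rw [hcgf, iteratedDeriv_two_cgf hint, deriv_cgf_zero hint, integral_re_trace_haar_eq_zero (by omega), mgf_zero]
  simp only [zero_mul, Real.exp_zero, mul_one, zero_div, div_one]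
  rw [haarSqReTrace_eq_half hN]
  norm_num

/-- **THE `SU(N)` PLAQUETTE HAS SLOPE `1/(2N)` AT `β = 0`, FOR EVERY `N ≥ 3`** (GEN-16's `SU(3)` strong-coupling
slope `1/18` per table unit `β_table = 3β` is `(1/3)·(1/6)`). -/
theorem hasDerivAt_specialUnitary_plaquette_zero (N : ℕ) (hN : 3 ≤ N) :
    HasDerivAt (fun β : ℝ =>
      (∫ u, ((u : Matrix.specialUnitaryGroup (Fin N) ℂ) : Matrix (Fin N) (Fin N) ℂ).trace.re / N *
          Real.exp (-(β * ((N : ℝ) - ((u : Matrix.specialUnitaryGroup (Fin N) ℂ) : Matrix (Fin N) (Fin N) ℂ).trace.re)))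
        ∂(haarProbability (Matrix.specialUnitaryGroup (Fin N) ℂ)))
      / (∫ u, Real.exp (-(β * ((N : ℝ) - ((u : Matrix.specialUnitaryGroup (Fin N) ℂ) :
          Matrix (Fin N) (Fin N) ℂ).trace.re))) ∂(haarProbability (Matrix.specialUnitaryGroup (Fin N) ℂ))))
      (1 / (2 * N)) 0 := by
  haveI : NeZero N := ⟨by omega⟩
  simp_rw [specialUnitary_plaquette_eq_deriv_log_tsum_det]
  have ha := (analyticOnNhd_cgf_univ (aestronglyMeasurable_trace_re_specialUnitaryGroup N)
    (fun u => abs_trace_re_le_card_su u))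
  have hcgf : (fun x : ℝ => Real.log (∑' q : ℤ, (Matrix.of fun i j : Fin N =>
      besselI (q + (i : ℤ) - (j : ℤ)).natAbs x).det))
      = cgf (fun u : Matrix.specialUnitaryGroup (Fin N) ℂ => ((u : Matrix.specialUnitaryGroup (Fin N) ℂ) :
          Matrix (Fin N) (Fin N) ℂ).trace.re) (haarProbability (Matrix.specialUnitaryGroup (Fin N) ℂ)) :=
    funext fun x => by rw [cgf, mgf_trace_re_specialUnitaryGroup]
  have h2 := iteratedDeriv_two_log_tsum_det_besselI_zero N hN
  rw [iteratedDeriv_succ, iteratedDeriv_one] at h2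
  have hd : HasDerivAt (deriv fun x : ℝ => Real.log (∑' q : ℤ, (Matrix.of fun i j : Fin N =>
      besselI (q + (i : ℤ) - (j : ℤ)).natAbs x).det)) (1 / 2) 0 := by
    rw [← h2]
    rw [hcgf]
    exact ((ha 0 (Set.mem_univ 0)).deriv).differentiableAt.hasDerivAt
  have h := hd.const_mul (1 / (N : ℝ))
  refine h.congr_deriv ?_
  ring

end StrongCoupling

/-! ### 3. The plaquette variance is `(log Z)''/N²` -/

/-- **`SU(N)`, `N ≥ 1`: the variance of the plaquette under the one-plaquette law at coupling `β` is
`(1/N²) · (log Σ_q det[I_{|q+i−j|}])''(β)`.** -/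
theorem specialUnitary_plaquette_variance_eq (N : ℕ) [NeZero N] (β : ℝ) :
    (∫ u, (((u : Matrix.specialUnitaryGroup (Fin N) ℂ) : Matrix (Fin N) (Fin N) ℂ).trace.re / N) ^ 2 *
          Real.exp (-(β * ((N : ℝ) - ((u : Matrix.specialUnitaryGroup (Fin N) ℂ) : Matrix (Fin N) (Fin N) ℂ).trace.re)))
        ∂(haarProbability (Matrix.specialUnitaryGroup (Fin N) ℂ)))
      / (∫ u, Real.exp (-(β * ((N : ℝ) - ((u : Matrix.specialUnitaryGroup (Fin N) ℂ) :
          Matrix (Fin N) (Fin N) ℂ).trace.re))) ∂(haarProbability (Matrix.specialUnitaryGroup (Fin N) ℂ)))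
      - ((∫ u, ((u : Matrix.specialUnitaryGroup (Fin N) ℂ) : Matrix (Fin N) (Fin N) ℂ).trace.re / N *
          Real.exp (-(β * ((N : ℝ) - ((u : Matrix.specialUnitaryGroup (Fin N) ℂ) : Matrix (Fin N) (Fin N) ℂ).trace.re)))
        ∂(haarProbability (Matrix.specialUnitaryGroup (Fin N) ℂ)))
      / (∫ u, Real.exp (-(β * ((N : ℝ) - ((u : Matrix.specialUnitaryGroup (Fin N) ℂ) :
          Matrix (Fin N) (Fin N) ℂ).trace.re))) ∂(haarProbability (Matrix.specialUnitaryGroup (Fin N) ℂ)))) ^ 2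
      = 1 / N ^ 2 * iteratedDeriv 2 (fun x : ℝ =>
          Real.log (∑' q : ℤ, (Matrix.of fun i j : Fin N => besselI (q + (i : ℤ) - (j : ℤ)).natAbs x).det)) β := by
  have hint := mem_interior_integrableExpSet_of_abs_le_const
    (aestronglyMeasurable_trace_re_specialUnitaryGroup N) (fun u => abs_trace_re_le_card_su u) β
  have hcgf : (fun x : ℝ => Real.log (∑' q : ℤ, (Matrix.of fun i j : Fin N =>
      besselI (q + (i : ℤ) - (j : ℤ)).natAbs x).det))
      = cgf (fun u : Matrix.specialUnitaryGroup (Fin N) ℂ => ((u : Matrix.specialUnitaryGroup (Fin N) ℂ) :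
          Matrix (Fin N) (Fin N) ℂ).trace.re) (haarProbability (Matrix.specialUnitaryGroup (Fin N) ℂ)) :=
    funext fun x => by rw [cgf, mgf_trace_re_specialUnitaryGroup]
  rw [specialUnitary_plaquette_eq_deriv_log_tsum_det, hcgf, iteratedDeriv_two_cgf hint, deriv_cgf hint, mgf]
  have hsplit : ∀ u : Matrix.specialUnitaryGroup (Fin N) ℂ,
      Real.exp (-(β * ((N : ℝ) - ((u : Matrix.specialUnitaryGroup (Fin N) ℂ) : Matrix (Fin N) (Fin N) ℂ).trace.re)))
        = Real.exp (-(N * β)) *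
          Real.exp (β * ((u : Matrix.specialUnitaryGroup (Fin N) ℂ) : Matrix (Fin N) (Fin N) ℂ).trace.re) := by
    intro u; rw [← Real.exp_add]; congr 1; ring
  simp_rw [hsplit]
  have h1 : ∀ u : Matrix.specialUnitaryGroup (Fin N) ℂ,
      (((u : Matrix.specialUnitaryGroup (Fin N) ℂ) : Matrix (Fin N) (Fin N) ℂ).trace.re / N) ^ 2 *
        (Real.exp (-(N * β)) *
          Real.exp (β * ((u : Matrix.specialUnitaryGroup (Fin N) ℂ) : Matrix (Fin N) (Fin N) ℂ).trace.re))
      = Real.exp (-(N * β)) / N ^ 2 * (((u : Matrix.specialUnitaryGroup (Fin N) ℂ) : Matrix (Fin N) (Fin N) ℂ).trace.re ^ 2 *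
          Real.exp (β * ((u : Matrix.specialUnitaryGroup (Fin N) ℂ) : Matrix (Fin N) (Fin N) ℂ).trace.re)) := by
    intro u; ring
  simp_rw [h1]
  rw [integral_const_mul, integral_const_mul]
  have hZ : 0 < ∫ u, Real.exp (β * ((u : Matrix.specialUnitaryGroup (Fin N) ℂ) : Matrix (Fin N) (Fin N) ℂ).trace.re)
      ∂(haarProbability (Matrix.specialUnitaryGroup (Fin N) ℂ)) :=
    integral_exp_pos (integrable_exp_mul_of_abs_le_const
      (aestronglyMeasurable_trace_re_specialUnitaryGroup N) (fun u => abs_trace_re_le_card_su u) β)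
  have he : Real.exp (-(N * β)) ≠ 0 := (Real.exp_pos _).ne'
  have hN : (N : ℝ) ≠ 0 := Nat.cast_ne_zero.2 (NeZero.ne N)
  field_simp


/-! ### 4. Weak coupling: the `SU(N)` plaquette tends to `1` -/

/-- The set `{Re tr U > N − ε}` has positive Haar measure in `SU(N)` (it is open and contains `1`). -/
theorem haar_specialUnitaryGroup_trace_re_gt_pos (N : ℕ) {ε : ℝ} (hε : 0 < ε) :
    0 < haarProbability (Matrix.specialUnitaryGroup (Fin N) ℂ)
      {u | (N : ℝ) - ε < ((u : Matrix.specialUnitaryGroup (Fin N) ℂ) : Matrix (Fin N) (Fin N) ℂ).trace.re} := by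
  haveI : (haarProbability (Matrix.specialUnitaryGroup (Fin N) ℂ)).IsHaarMeasure := Measure.isHaarMeasure_haarMeasure ⊤
  have hopen : IsOpen {u : Matrix.specialUnitaryGroup (Fin N) ℂ |
      (N : ℝ) - ε < ((u : Matrix.specialUnitaryGroup (Fin N) ℂ) : Matrix (Fin N) (Fin N) ℂ).trace.re} :=
    isOpen_lt continuous_const (Complex.continuous_re.comp (continuous_id.matrix_trace.comp continuous_subtype_val))
  refine hopen.measure_pos _ ⟨1, ?_⟩
  simp only [Set.mem_setOf_eq]
  rw [show (((1 : Matrix.specialUnitaryGroup (Fin N) ℂ)) : Matrix (Fin N) (Fin N) ℂ) = 1 from rfl, Matrix.trace_one]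
  simp only [Complex.natCast_re, Fintype.card_fin]
  linarith

/-- **`(log Σ_q det[I_{|q+i−j|}])'(β) → N` as `β → ∞`** (`N ≥ 1`). -/
theorem tendsto_deriv_log_tsum_det_besselI_atTop (N : ℕ) [NeZero N] :
    Tendsto (deriv fun x : ℝ => Real.log (∑' q : ℤ, (Matrix.of fun i j : Fin N =>
      besselI (q + (i : ℤ) - (j : ℤ)).natAbs x).det)) atTop (𝓝 (N : ℝ)) := by
  have hcgf : (fun x : ℝ => Real.log (∑' q : ℤ, (Matrix.of fun i j : Fin N =>
      besselI (q + (i : ℤ) - (j : ℤ)).natAbs x).det))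
      = cgf (fun u : Matrix.specialUnitaryGroup (Fin N) ℂ => ((u : Matrix.specialUnitaryGroup (Fin N) ℂ) :
          Matrix (Fin N) (Fin N) ℂ).trace.re) (haarProbability (Matrix.specialUnitaryGroup (Fin N) ℂ)) :=
    funext fun x => by rw [cgf, mgf_trace_re_specialUnitaryGroup]
  rw [hcgf]
  exact tendsto_deriv_cgf_atTop (μ := haarProbability (Matrix.specialUnitaryGroup (Fin N) ℂ))
    (X := fun u : Matrix.specialUnitaryGroup (Fin N) ℂ =>
      ((u : Matrix.specialUnitaryGroup (Fin N) ℂ) : Matrix (Fin N) (Fin N) ℂ).trace.re)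
    (C := Fintype.card (Fin N)) (M := (N : ℝ))
    (Complex.continuous_re.comp (continuous_id.matrix_trace.comp continuous_subtype_val)).measurable
    (fun u => abs_trace_re_le_card_su u)
    (fun u => by simpa [Fintype.card_fin] using (abs_le.mp (abs_trace_re_le_card_su u)).2)
    (fun ε hε => haar_specialUnitaryGroup_trace_re_gt_pos N hε)

/-- **THE `SU(N)` ONE-PLAQUETTE PLAQUETTE TENDS TO `1` AT WEAK COUPLING, EVERY `N ≥ 1`.** -/
theorem tendsto_specialUnitary_plaquette_atTop (N : ℕ) [NeZero N] :
    Tendsto (fun β : ℝ =>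
      (∫ u, ((u : Matrix.specialUnitaryGroup (Fin N) ℂ) : Matrix (Fin N) (Fin N) ℂ).trace.re / N *
          Real.exp (-(β * ((N : ℝ) - ((u : Matrix.specialUnitaryGroup (Fin N) ℂ) : Matrix (Fin N) (Fin N) ℂ).trace.re)))
        ∂(haarProbability (Matrix.specialUnitaryGroup (Fin N) ℂ)))
      / (∫ u, Real.exp (-(β * ((N : ℝ) - ((u : Matrix.specialUnitaryGroup (Fin N) ℂ) :
          Matrix (Fin N) (Fin N) ℂ).trace.re))) ∂(haarProbability (Matrix.specialUnitaryGroup (Fin N) ℂ))))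
      atTop (𝓝 1) := by
  simp_rw [specialUnitary_plaquette_eq_deriv_log_tsum_det]
  have hN : (N : ℝ) ≠ 0 := Nat.cast_ne_zero.2 (NeZero.ne N)
  have h := (tendsto_deriv_log_tsum_det_besselI_atTop N).const_mul (1 / (N : ℝ))
  rwa [show 1 / (N : ℝ) * N = 1 by field_simp] at h

/-! ### 5. Global consequences: `Σ_q det[I_{|q+i−j|}(0)] = 1` and `Σ_q det[I_{|q+i−j|}(x)] ≥ 1` -/

/-- **`Σ_{q∈ℤ} det[I_{|q+i−j|}(0)]_{N×N} = 1`** (`N ≥ 1`; `mgf` at `0` of a probability measure; GEN-16 proved `N = 3`). -/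
theorem tsum_det_besselI_shift_zero (N : ℕ) [NeZero N] :
    ∑' q : ℤ, (Matrix.of fun i j : Fin N => besselI (q + (i : ℤ) - (j : ℤ)).natAbs 0).det = 1 := by
  rw [← mgf_trace_re_specialUnitaryGroup N 0, mgf_zero]

/-- **`Σ_{q∈ℤ} det[I_{|q+i−j|}(x)]_{N×N} ≥ 1` for every `N ≥ 2` and real `x`** (`log Z` convex with `(log Z)'(0) = 0`:
Jensen for `∫_{SU(N)} e^{x Re tr U} dU` with `∫ Re tr = 0`). -/
theorem one_le_tsum_det_besselI (N : ℕ) (hN : 2 ≤ N) (x : ℝ) :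
    1 ≤ ∑' q : ℤ, (Matrix.of fun i j : Fin N => besselI (q + (i : ℤ) - (j : ℤ)).natAbs x).det := by
  haveI : NeZero N := ⟨by omega⟩
  set f : ℝ → ℝ := fun x => Real.log (∑' q : ℤ, (Matrix.of fun i j : Fin N =>
    besselI (q + (i : ℤ) - (j : ℤ)).natAbs x).det) with hf
  have hcgf : f = cgf (fun u : Matrix.specialUnitaryGroup (Fin N) ℂ => ((u : Matrix.specialUnitaryGroup (Fin N) ℂ) :
      Matrix (Fin N) (Fin N) ℂ).trace.re) (haarProbability (Matrix.specialUnitaryGroup (Fin N) ℂ)) :=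
    funext fun x => by rw [hf, cgf, mgf_trace_re_specialUnitaryGroup]
  have ha := analyticOnNhd_cgf_univ (aestronglyMeasurable_trace_re_specialUnitaryGroup N) (fun u => abs_trace_re_le_card_su u)
  rw [← hcgf] at ha
  have hd : Differentiable ℝ f := fun t => (ha t (Set.mem_univ t)).differentiableAt
  have hmono : Monotone (deriv f) := by
    rw [hcgf]; exact monotone_deriv_cgf (aestronglyMeasurable_trace_re_specialUnitaryGroup N) (fun u => abs_trace_re_le_card_su u)
  have hd0 : deriv f 0 = 0 := deriv_log_tsum_det_besselI_zero N hN
  have hf0 : f 0 = 0 := by simp only [hf, tsum_det_besselI_shift_zero, Real.log_one]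
  have hfx : 0 ≤ f x := by
    rcases le_total 0 x with hx | hx
    · have hm : MonotoneOn f (Set.Ici 0) :=
        monotoneOn_of_deriv_nonneg (convex_Ici 0) hd.continuous.continuousOn (hd.differentiableOn)
          fun t ht => by
            rw [← hd0]
            exact hmono (le_of_lt (by simpa using ht))
      simpa [hf0] using hm (Set.mem_Ici.2 le_rfl) (Set.mem_Ici.2 hx) hx
    · have hm : AntitoneOn f (Set.Iic 0) :=
        antitoneOn_of_deriv_nonpos (convex_Iic 0) hd.continuous.continuousOn (hd.differentiableOn)
          fun t ht => by
            rw [← hd0]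
            exact hmono (le_of_lt (by simpa using ht))
      simpa [hf0] using hm (Set.mem_Iic.2 hx) (Set.mem_Iic.2 le_rfl) hx
  have hpos : 0 < ∑' q : ℤ, (Matrix.of fun i j : Fin N => besselI (q + (i : ℤ) - (j : ℤ)).natAbs x).det := by
    rw [← integral_haar_specialUnitaryGroup_fin_exp_mul_trace_re]
    exact integral_exp_pos (integrable_exp_mul_of_abs_le_const
      (aestronglyMeasurable_trace_re_specialUnitaryGroup N) (fun u => abs_trace_re_le_card_su u) x)
  rwa [hf, Real.log_nonneg_iff hpos] at hfx

end Summit.Ventures.LatticeQCDFlow.Scoring
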